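import Literature.Computability.Cryptography.Sweep1
import Literature.Computability.Cryptography.CryptoFoundationsOneWayFunctions
import Literature.Computability.MetaComplexity.DistProblemsProofs
import Literature.Computability.MetaComplexity.HeuristicClassesDeterministicProofs
import HarnessLib

/-!
# Liu–Pass, *On one-way functions and Kolmogorov complexity*: architecture of the main theorem; no Pessiland: `NoPessiland → NoPessilandHeur`

D-0014 companion of `Sweep1.lean` for the named fact
`Literature.Computability.Cryptography.OWFExist_iff_isMildlyHardOnAverage_liuPassKt` (crypto-foundations.S02,
Liu–Pass FOCS 2020, Thm 1.1 in the form of the remark following it: for every polynomial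
`t(n) ≥ (1+ε)n`, OWFs exist iff `K^t` is mildly hard-on-average). This file

1. vendors the halves of Liu–Pass's proof as their own named facts, for the tree's *abstract*
   efficient universal machine `Literature.Computability.MetaComplexity.UniversalMachine` (a hypothesis structure quantified
   in every `K^t` statement):
   * `weakOWFExist_of_isMildlyHardOnAverage_liuPassKt` — Thm 4.1 (OWFs from mild average-case
     `K^t`-hardness): if `K^t` is mildly hard-on-average for a polynomial `t(n) ≥ (1+ε)n` then a
     weak one-way function exists (reduced to two TM2 efficiency facts in `LiuPassWeakOWF.lean`);
   * `exists_isMildlyHardOnAverage_liuPassKt_of_OWFExist` — Thm 3.1 (Main Theorem) (a) ⇒ (b): if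
     one-way functions exist then `K^t` is mildly hard-on-average for *some* polynomial `t`;
   * `isMildlyHardOnAverage_liuPassKt_of_OWFExist` — Thm 3.1 (a) ⇒ (c) specialised to exact
     computation, i.e. the remark after Thm 3.1: if one-way functions exist then `K^t` is mildly
     hard-on-average for *every* polynomial `t(n) ≥ (1+ε)n` (reduced in `LiuPassCondEPPRG.lean`,
     which proves Thm 5.2 for the abstract `U`, to the §5.3 input and one efficiency fact);
   the remaining ingredient, Yao's amplification of weak one-way functions (Liu–Pass Thm 2.3
   = [Yao82]), is the existing fact `Literature.Computability.Cryptography.weakOWFExist_iff_OWFExist` (S05);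
2. proves from these the direction `←` of S02 for every `U` and every `t(n) ≥ (1+ε)n`
   (`OWFExist_of_isMildlyHardOnAverage_liuPassKt`), Thm 1.1 = Thm 3.1 (a) ⇔ (b)
   (`OWFExist_iff_exists_isMildlyHardOnAverage_liuPassKt_of`), and **S02 itself**
   (`OWFExist_iff_isMildlyHardOnAverage_liuPassKt_of`, with the forward direction as an explicit
   hypothesis, and `OWFExist_iff_isMildlyHardOnAverage_liuPassKt_of_forward`, from the three facts);
3. records Thm 1.1 = Thm 3.1 (a) ⇔ (b) as the named fact
   `OWFExist_iff_exists_isMildlyHardOnAverage_liuPassKt` (implied by S02,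
   `OWFExist_iff_exists_isMildlyHardOnAverage_liuPassKt_of_S02`);
4. (last section) discharges the second named fact of `Sweep1.lean` that is a real implication
   between vendored statements, `Literature.Computability.Cryptography.noPessilandHeur_of_noPessiland`
   (crypto-foundations.S15: the `AvgP` form of Impagliazzo's "there is no Pessiland" implies the
   `HeurBPP` form), as `noPessilandHeur_of_noPessiland_holds`, from the inclusion
   `AvgP ⊆ HeurP ⊆ HeurBPP` assembled from the discharged prelude facts `AvgP_subset_HeurP_holds`
   (`MetaComplexity/DistProblemsProofs.lean`) and `HeurP_subset_HeurBPP_holds`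
   (`MetaComplexity/HeuristicClassesDeterministicProofs.lean`) — Bogdanov–Trevisan 2006, §2.2
   (closing remark) and §2.3 ("the standard containments `Avg C ⊆ Heur C`"); and restores the
   interim derivation of the `DistNP` form of crypto-foundations.S25 from its `(NP, U)` form
   (`DistNP_not_subset_HeurBPP_of_OWFExist_of`, via `uniformEnsemble_mem_PSamp_holds`).

## The printed architecture (Liu–Pass 2020, arXiv:2009.11514v1)

* §2.2: `U(Π, 1^t)` is "the output of `M(w)` when emulated on `U` for `t` steps", where
  `Π = (M, w)`, and "`U(Π, 1^t)` can be computed in time `poly(|Π|, t)`"; Fact 2.1: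
  `K^t(x) ≤ |x| + c` for every `t(n) > 0`. Def 2.4: (mild) average-case hardness.
* Thm 3.1 (§3 Main Theorem): (a) OWFs exist ⇔ (b) `∃` polynomial `t`, `K^t` mildly HoA ⇔ (c)
  `∀ d, ε`, `∀` polynomial `t(n) ≥ (1+ε)n`, `K^t` is mildly HoA to `(d log n)`-approximate;
  proved as (b) ⇒ (a) (Thm 4.1), (a) ⇒ (c) (§5), (c) ⇒ (b) trivial. Thm 1.1 as numbered in
  arXiv:2009.11514v1 is the `K^{poly}` form (a) ⇔ (b); the form "for every polynomial
  `t(n) ≥ (1+ε)n`, OWF ⇔ `K^t` mildly HoA" (S02) is the unnumbered remark following Thm 1.1 and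
  Thm 3.1 (p. 9).
* Thm 4.1 (§4): `K^t` `1/p`-HoA ⇒ `f(ℓ ‖ Π') = ℓ ‖ U(Π'_{≤ ℓ}, 1^{t(n)})` is a `1/q`-weak OWF
  with `q(n) = 2^{2c+3} n p(n)²` (averaging over the inverter's coins, then a heuristic that runs
  the inverter on `(i ‖ z)` for all `i ≤ n + c`), "and thus also a OWF" by [Yao82]. In print this
  holds for every `t(n) > 0` (print's `U` has Fact 2.1 at every budget).
* §5.1 (Def 5.1): conditionally-secure entropy-preserving PRGs (cond EP-PRG); Thm 5.2 (§5.2):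
  rate-1 `1/n²`-cond EP-PRGs `{0,1}^n → {0,1}^{n + γ log n}` for every `γ` ⇒ (c), using the
  counting bound `#{x : K^t(x) < m - (γ/4) log n} < 2^{m - (γ/4) log n}` and the upper bound
  `K^t(G(s)) ≤ |s| + O(1)` at budget `t(|G(s)|)`, "since the running time of `G(s)` is bounded
  by `t(|s|)`" (eq. (2)); §5.3: OWF ⇒ regular `S`-OWF (Lemma 5.4) ⇒ dense function plus
  Goldreich–Levin bits (Lemma 5.3, after Goldreich 2001 / Yu) ⇒ `1/n^δ`-cond EP-PRG (Thm 5.5) ⇒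
  rate-1 by padding (Thm 5.6).

## The universal machine (why the forward direction is a separate fact)

`Sweep1.lean` states S02 for **every** `U : UniversalMachine` and every polynomial
`t(n) ≥ (1+ε)n`. The tree's `UniversalMachine.sim` grants universality with a polynomial
overhead `p` depending on the simulated machine (`M.OutputsWithin w y s → U.run (boolPair e w)
(p.eval s) = some y`), budgets counting steps of `U`, whereas print's §2.2 lets the budget count
the emulated machine's steps. Print's eq. (2) as written ("`K^t(G(s)) ≤ n + O(1)` because `G` is
rate-1 efficient and `t(n) ≥ (1+ε)n`") uses the latter convention; in the tree's model the same
bound is obtained from the *form* of the rate-1 generator of Thm 5.6, `G_γ(s₀ ‖ s₁) = s₀ ‖ G'(s₁)`: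
a stack machine computes `G'` on the short block `s₁` and passes `s₀` through untouched in time
depending on `|s₁|` only, so `sim` prints `G_γ`'s output within `p(T_{G'}(|s₁|)) ≤ |s₀| ≤ t(m)`
steps once the pass-through block is long enough (`UniversalMachine.exists_ktAt_le_of_outputsWithin`,
`UniversalMachine.run_mono`), the extra `O(log n)` bits describing `|s₁|` being absorbed by a larger
`γ`. Accordingly the forward direction is vendored for every abstract `U` and every
`t(n) ≥ (1+ε)n` (`isMildlyHardOnAverage_liuPassKt_of_OWFExist`); its reduction to the §5.3
construction is carried out in `LiuPassCondEPPRG.lean` (Thm 5.2 proved with the low-`K^t`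
property of the generator's outputs as an explicit hypothesis). The direction `←` of S02
(Thm 4.1 + Yao) needs only `U.polyTime`, Fact 2.1 (`liuPassKt_le_length_add`, which is where the
tree needs `t(n) ≥ (1+ε)n`: `UniversalMachine.print`) and counting.

All declarations are sorry-free; cited results enter as hypotheses `(h : X)` (D-0014 style).

## References

* Y. Liu, R. Pass, *On one-way functions and Kolmogorov complexity*, FOCS 2020, 1243–1254;
  arXiv:2009.11514v1: Thm 1.1 and the remark following it, §2.2 (Fact 2.1), Def 2.4 (mild HoA),
  Thm 3.1 (Main Theorem) and the remark following it (p. 9), Thm 4.1 (OWFs from mild avg-case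
  `K^t`-hardness), Thm 5.2 (avg-case `K^t`-hardness from cond EP-PRGs), §5.3 (Lemmas 5.3–5.4;
  Thm 5.5: cond EP-PRGs from OWFs; Thm 5.6: rate-1 padding). doi:10.1109/FOCS46700.2020.00118
* A. C. Yao, *Theory and applications of trapdoor functions*, FOCS 1982 (amplification);
  O. Goldreich, *Foundations of Cryptography I*, CUP 2001, Thm 2.3.2.
* A. Bogdanov, L. Trevisan, *Average-Case Complexity*, Found. Trends TCS 2 (2006), §2.2 (closing
  remark: "an errorless algorithm can be easily turned into a heuristic algorithm by replacing the
  failure symbol `⊥` by an arbitrary output"; arXiv:cs/0606037v3, after Def. 11) and §2.3 ("for the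
  non-uniform and randomized heuristic classes, we have the standard containments
  `Avg C ⊆ Heur C`"); R. Impagliazzo, *A personal view of average-case complexity*, CCC 1995, §4.
-/

namespace Literature.Computability.Cryptography

open Filter _root_.Computability Complexity MetaComplexity

/-! ### The two halves of Liu–Pass's proof, as named facts -/

/-- **Liu–Pass 2020, Thm 4.1 (OWFs from mild average-case `K^t`-hardness).** Let `U` be an
efficient universal machine and `t(n) ≥ (1+ε)n` (`ε > 0`) a polynomial. If `K^t` is mildly
hard-on-average (`1/p`-HoA for some polynomial `p > 0`, outputs in binary) then a weak one-way
function exists — in print, `f(ℓ ‖ Π') = ℓ ‖ U(Π'_{≤ ℓ}, 1^{t(n)})` on inputs of length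
`n + c + ⌈log (n+c)⌉`, padded to all lengths, is `1/q`-weakly one-way for
`q(n) = 2^{2c+3} n p(n)²`. (The printed theorem adds "and thus also a OWF", which is Yao's
amplification, the separate fact `weakOWFExist_iff_OWFExist`.) The printed proof uses only the
efficiency of `U` (`UniversalMachine.polyTime`), Fact 2.1 (`K^t(x) ≤ |x| + c`) and counting, so
it applies verbatim to every `U : UniversalMachine`. **Restriction w.r.t. print:** Thm 4.1 is
stated for every polynomial `t(n) > 0`, print's `U` having Fact 2.1 at every budget; the tree's
`UniversalMachine.print` field yields Fact 2.1 only for budgets `≥ (1+ε)|x|`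
(`liuPassKt_le_length_add`), whence the hypothesis `t(n) ≥ (1+ε)n` here (a documented weakening).
The reduction is carried out in `LiuPassWeakOWF.lean`, which derives this fact from two TM2
efficiency facts. [Y. Liu, R. Pass, FOCS 2020, Thm 4.1; arXiv:2009.11514 §4]
[cite: LiuPassFOCS2020, Thm 4.1] -/
def weakOWFExist_of_isMildlyHardOnAverage_liuPassKt : Prop :=
  ∀ (U : UniversalMachine) (t : Polynomial ℕ) {ε : ℝ} (_hε : 0 < ε)
    (_ht : ∀ n : ℕ, (1 + ε) * n ≤ ((t.eval n : ℕ) : ℝ)),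
    IsMildlyHardOnAverage encodeNat (liuPassKt U t) → WeakOWFExist

/-- **Liu–Pass 2020, Thm 3.1 (Main Theorem), (a) ⇒ (b), via §5** (mild average-case
`K^t`-hardness from OWFs). If one-way functions exist then, for every efficient universal machine
`U`, there is a polynomial time bound `t` — which may be taken to satisfy `t(n) ≥ (1+ε)n` for some
`ε > 0`, the regime of clause (c) — such that `K^t` is mildly hard-on-average. In print this is
(a) ⇒ (c) ⇒ (b): OWF ⇒ rate-1 `1/n²`-cond EP-PRGs `G : {0,1}^n → {0,1}^{n + γ log n}`
(Thms 5.5, 5.6) ⇒ every PPT heuristic for `K^t` errs on a `1/p(n)` fraction,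
`p(n) = 2 n^{2(α+γ+1)}` (Thm 5.2). This `∃ t` form is Thm 1.1 as numbered in arXiv:2009.11514v1;
the per-`t` form is the separate fact `isMildlyHardOnAverage_liuPassKt_of_OWFExist` below, from
which this one follows (`exists_isMildlyHardOnAverage_liuPassKt_of_OWFExist_of_forward`).
[Y. Liu, R. Pass, FOCS 2020, Thm 3.1 (a) ⇒ (b); Thm 5.2, Thms 5.5–5.6; arXiv:2009.11514]
[cite: LiuPassFOCS2020, Thm 3.1 (a)⇒(b); Thms 5.2, 5.5, 5.6] -/
def exists_isMildlyHardOnAverage_liuPassKt_of_OWFExist : Prop :=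
  OWFExist → ∀ U : UniversalMachine, ∃ (t : Polynomial ℕ) (ε : ℝ), 0 < ε ∧
    (∀ n : ℕ, (1 + ε) * n ≤ ((t.eval n : ℕ) : ℝ)) ∧ IsMildlyHardOnAverage encodeNat (liuPassKt U t)

/-! ### Thm 1.1 = Thm 3.1 (a) ⇔ (b): the `K^{poly}` form -/

/-- **Liu–Pass 2020, Thm 1.1 = Thm 3.1 (a) ⇔ (b)** ("one-way functions exist iff `K^{poly}` is
mildly hard-on-average"), for every efficient universal machine `U`: one-way functions exist iff
there is a polynomial `t` (with `t(n) ≥ (1+ε)n` for some `ε > 0`, the regime in which the tree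
has Fact 2.1 `K^t(x) ≤ |x| + c`, `liuPassKt_le_length_add`) such that `K^t` is mildly
hard-on-average (`IsMildlyHardOnAverage`, Def 2.4, outputs in binary). This is the `∃ t`
companion of S02 (`OWFExist_iff_isMildlyHardOnAverage_liuPassKt`, the per-`t` remark form), and is
implied by it (`OWFExist_iff_exists_isMildlyHardOnAverage_liuPassKt_of_S02`). Proved from the two
halves and Yao's amplification in `OWFExist_iff_exists_isMildlyHardOnAverage_liuPassKt_of`.
[Y. Liu, R. Pass, FOCS 2020, Thm 1.1 and Thm 3.1 (a) ⇔ (b); arXiv:2009.11514]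
[cite: LiuPassFOCS2020, Thm 1.1 (= Thm 3.1 (a)⇔(b))] -/
def OWFExist_iff_exists_isMildlyHardOnAverage_liuPassKt : Prop :=
  ∀ U : UniversalMachine, OWFExist ↔ ∃ (t : Polynomial ℕ) (ε : ℝ), 0 < ε ∧
    (∀ n : ℕ, (1 + ε) * n ≤ ((t.eval n : ℕ) : ℝ)) ∧ IsMildlyHardOnAverage encodeNat (liuPassKt U t)

/-! ### Assembly (real proofs from the named facts) -/

/-- **S02, direction `←`, for every `U` and every `t(n) ≥ (1+ε)n`** (Liu–Pass 2020, Thm 4.1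
+ Thm 2.3 = [Yao82]): if `K^t` is mildly hard-on-average then one-way functions exist. One line
from the facts `weakOWFExist_of_isMildlyHardOnAverage_liuPassKt` (Thm 4.1) and
`weakOWFExist_iff_OWFExist` (Yao's amplification, S05). [Y. Liu, R. Pass, FOCS 2020, Thm 4.1 with
Thm 2.3; arXiv:2009.11514] [cite: LiuPassFOCS2020, Thm 4.1] -/
theorem OWFExist_of_isMildlyHardOnAverage_liuPassKt
    (h₄ : weakOWFExist_of_isMildlyHardOnAverage_liuPassKt) (hYao : weakOWFExist_iff_OWFExist)
    (U : UniversalMachine) (t : Polynomial ℕ) {ε : ℝ} (hε : 0 < ε)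
    (ht : ∀ n : ℕ, (1 + ε) * n ≤ ((t.eval n : ℕ) : ℝ))
    (hK : IsMildlyHardOnAverage encodeNat (liuPassKt U t)) : OWFExist :=
  hYao.mp (h₄ U t hε ht hK)

/-- **Liu–Pass 2020, Thm 1.1 = Thm 3.1 (a) ⇔ (b), assembled** from Thm 4.1
(`weakOWFExist_of_isMildlyHardOnAverage_liuPassKt`), Yao's amplification
(`weakOWFExist_iff_OWFExist`) and §5 (`exists_isMildlyHardOnAverage_liuPassKt_of_OWFExist`),
exactly as in print: "(b) implies (a) (Section 4) and (a) implies (c) (Section 5); (c) trivially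
implies (b)". [Y. Liu, R. Pass, FOCS 2020, Thm 3.1; arXiv:2009.11514]
[cite: LiuPassFOCS2020, Thm 3.1 (a)⇔(b)] -/
theorem OWFExist_iff_exists_isMildlyHardOnAverage_liuPassKt_of
    (h₄ : weakOWFExist_of_isMildlyHardOnAverage_liuPassKt) (hYao : weakOWFExist_iff_OWFExist)
    (h₅ : exists_isMildlyHardOnAverage_liuPassKt_of_OWFExist) :
    OWFExist_iff_exists_isMildlyHardOnAverage_liuPassKt :=
  fun U => ⟨fun hO => h₅ hO U,
    fun ⟨t, _ε, hε, ht, hK⟩ => OWFExist_of_isMildlyHardOnAverage_liuPassKt h₄ hYao U t hε ht hK⟩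

/-- The `∃ t` form is implied by S02 as vendored (instantiate S02 at `t = 2X`, `ε = 1`).
[Y. Liu, R. Pass, FOCS 2020, Thm 1.1 and Thm 3.1; arXiv:2009.11514]
[cite: LiuPassFOCS2020, Thm 1.1 (= Thm 3.1 (a)⇔(b))] -/
theorem OWFExist_iff_exists_isMildlyHardOnAverage_liuPassKt_of_S02
    (h : OWFExist_iff_isMildlyHardOnAverage_liuPassKt) :
    OWFExist_iff_exists_isMildlyHardOnAverage_liuPassKt := by
  intro U
  have h2 : ∀ n : ℕ, (1 + (1 : ℝ)) * n ≤ (((2 * Polynomial.X : Polynomial ℕ).eval n : ℕ) : ℝ) := by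
    intro n
    simp only [Polynomial.eval_mul, Polynomial.eval_ofNat, Polynomial.eval_X, Nat.cast_mul,
      Nat.cast_ofNat]
    norm_num
  refine ⟨fun hO => ⟨2 * Polynomial.X, 1, one_pos, h2, (h U (2 * Polynomial.X) one_pos h2).mp hO⟩,
    fun ⟨t, _ε, hε, ht, hK⟩ => (h U t hε ht).mpr hK⟩

/-- **S02 from its three ingredients, the forward direction explicit.** S02 (`∀ U`,
`∀ t(n) ≥ (1+ε)n`, OWF ⇔ `K^t` mildly HoA) follows from the Thm 4.1 fact, Yao's amplification, and
the *per-`t`* forward implication "OWF ⇒ `K^t` mildly HoA for every `t(n) ≥ (1+ε)n`" — Liu–Pass's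
clause (a) ⇒ (c) specialised to exact computation (the remark after Thm 3.1), vendored below as
the named fact `isMildlyHardOnAverage_liuPassKt_of_OWFExist`; see
`OWFExist_iff_isMildlyHardOnAverage_liuPassKt_of_forward`. [Y. Liu, R. Pass, FOCS 2020, Thm 1.1
and Thm 3.1 with the remarks following them; arXiv:2009.11514]
[cite: LiuPassFOCS2020, Thm 1.1 (remark: every t ≥ (1+ε)n)] -/
theorem OWFExist_iff_isMildlyHardOnAverage_liuPassKt_of
    (h₄ : weakOWFExist_of_isMildlyHardOnAverage_liuPassKt) (hYao : weakOWFExist_iff_OWFExist)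
    (hc : ∀ (U : UniversalMachine) (t : Polynomial ℕ) {ε : ℝ}, 0 < ε →
      (∀ n : ℕ, (1 + ε) * n ≤ ((t.eval n : ℕ) : ℝ)) →
        OWFExist → IsMildlyHardOnAverage encodeNat (liuPassKt U t)) :
    OWFExist_iff_isMildlyHardOnAverage_liuPassKt :=
  fun U t _ε hε ht =>
    ⟨hc U t hε ht, OWFExist_of_isMildlyHardOnAverage_liuPassKt h₄ hYao U t hε ht⟩

/-! ### The forward direction for every `U` and every `t(n) ≥ (1+ε)n`, and S02 from three facts -/

/-- **Liu–Pass 2020, Thm 3.1 (a) ⇒ (c) specialised to exact computation — the remark after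
Thm 3.1** ("a consequence of Theorem 3.1 is that for every polynomial `t(n) ≥ (1+ε)n`, where
`ε > 0` is a constant, mild average-case hardness of `K^t` is equivalent to the existence of one-way
functions", p. 9 of arXiv:2009.11514v1; likewise the remark after Thm 1.1). If one-way functions
exist then, for every efficient universal machine `U` and *every* polynomial `t(n) ≥ (1+ε)n`
(`ε > 0`), `K^t` is mildly hard-on-average. In print: OWF ⇒ (Thm 5.5) `1/n^δ`-cond EP-PRGs ⇒
(Thm 5.6, padding) rate-1 efficient `1/n²`-cond EP-PRGs `G_γ : {0,1}^n → {0,1}^{n + γ log n}` for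
every `γ` ⇒ (Thm 5.2) every PPT heuristic for `K^t` errs on a `1/p(n)` fraction,
`p(n) = 2 n^{2(α+γ+1)}`, the last step using `K^t(G(s)) ≤ |s| + O(1)` at budget `t(|G(s)|)`
(eq. (2)). For the tree's abstract `U` (polynomial simulation overhead, `UniversalMachine.sim`)
eq. (2) is supplied by the padded form `G_γ(s₀ ‖ s₁) = s₀ ‖ G'(s₁)` of Thm 5.6's generator (module
docstring, "The universal machine"); the reduction of this fact to the §5.3 construction plus one
efficiency fact, with Thm 5.2 proved, is `LiuPassCondEPPRG.lean`. Stated for the same regime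
`t(n) ≥ (1+ε)n` as S02. [Y. Liu, R. Pass, FOCS 2020, Thm 3.1 (a) ⇒ (c) and the remark following
it (p. 9); Thms 5.2, 5.5, 5.6; arXiv:2009.11514v1]
[cite: LiuPassFOCS2020, Thm 3.1 (a)⇒(c) and the remark following it; Thm 5.2] -/
def isMildlyHardOnAverage_liuPassKt_of_OWFExist : Prop :=
  ∀ (U : UniversalMachine) (t : Polynomial ℕ) {ε : ℝ} (_hε : 0 < ε)
    (_ht : ∀ n : ℕ, (1 + ε) * n ≤ ((t.eval n : ℕ) : ℝ)),
    OWFExist → IsMildlyHardOnAverage encodeNat (liuPassKt U t)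

/-- **crypto-foundations.S02 from three named facts** (Liu–Pass 2020, Thm 1.1 / the remark after
Thm 3.1: for every `U` and every polynomial `t(n) ≥ (1+ε)n`, OWFs exist iff `K^t` is mildly
hard-on-average): Thm 4.1 (`weakOWFExist_of_isMildlyHardOnAverage_liuPassKt`), Yao's
amplification (`weakOWFExist_iff_OWFExist`, S05) and the forward direction
(`isMildlyHardOnAverage_liuPassKt_of_OWFExist`). [Y. Liu, R. Pass, FOCS 2020, Thm 1.1 and the
remark following Thm 3.1; arXiv:2009.11514] [cite: LiuPassFOCS2020, Thm 1.1 (remark: every t ≥ (1+ε)n)] -/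
theorem OWFExist_iff_isMildlyHardOnAverage_liuPassKt_of_forward
    (h₄ : weakOWFExist_of_isMildlyHardOnAverage_liuPassKt) (hYao : weakOWFExist_iff_OWFExist)
    (h₅ : isMildlyHardOnAverage_liuPassKt_of_OWFExist) :
    OWFExist_iff_isMildlyHardOnAverage_liuPassKt :=
  OWFExist_iff_isMildlyHardOnAverage_liuPassKt_of h₄ hYao fun U t _ hε ht hO => h₅ U t hε ht hO

/-- The `∃ t` fact (Thm 3.1 (a) ⇒ (b)) from the per-`t` fact: take `t = 2X`, `ε = 1`.
[Y. Liu, R. Pass, FOCS 2020, Thm 3.1; arXiv:2009.11514] [cite: LiuPassFOCS2020, Thm 3.1 (a)⇒(b)] -/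
theorem exists_isMildlyHardOnAverage_liuPassKt_of_OWFExist_of_forward
    (h₅ : isMildlyHardOnAverage_liuPassKt_of_OWFExist) :
    exists_isMildlyHardOnAverage_liuPassKt_of_OWFExist := by
  intro hO U
  have h2 : ∀ n : ℕ, (1 + (1 : ℝ)) * n ≤ (((2 * Polynomial.X : Polynomial ℕ).eval n : ℕ) : ℝ) := by
    intro n
    simp only [Polynomial.eval_mul, Polynomial.eval_ofNat, Polynomial.eval_X, Nat.cast_mul,
      Nat.cast_ofNat]
    norm_num
  exact ⟨2 * Polynomial.X, 1, one_pos, h2, h₅ U _ one_pos h2 hO⟩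

/-! ### crypto-foundations.S15: `NoPessiland → NoPessilandHeur` (discharge)

`Sweep1.lean` records Impagliazzo's "there is no Pessiland" in two readings, `NoPessiland`
(`DistNP ⊄ AvgP ⇒` one-way functions exist) and `NoPessilandHeur` (`DistNP ⊄ HeurBPP ⇒` one-way
functions exist), and the implication between them as the named fact
`noPessilandHeur_of_noPessiland`. The implication is the contrapositive of `AvgP ⊆ HeurBPP` on
`DistNP`: if `DistNP ⊆ AvgP` then `DistNP ⊆ HeurBPP`. In print, `AvgP ⊆ HeurP` is the closing
remark of Bogdanov–Trevisan §2.2 (replace `⊥` by an arbitrary answer) and `HeurP ⊆ HeurBPP` is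
implicit in §2.3 (a deterministic scheme is a randomized one ignoring its coins; "the standard
containments"); both are discharged prelude facts of the tree. -/

/-- **Discharge of `noPessilandHeur_of_noPessiland`** (`NoPessiland → NoPessilandHeur`,
crypto-foundations.S15): if `DistNP ⊄ HeurBPP` then a fortiori `DistNP ⊄ AvgP`, because
`AvgP ⊆ HeurBPP`; hence the `AvgP` reading of "there is no Pessiland" implies the `HeurBPP`
reading. The inclusion `AvgP ⊆ HeurBPP` is assembled as `AvgP ⊆ HeurP ⊆ HeurBPP` from the
discharged prelude facts `AvgP_subset_HeurP_holds` (Bogdanov–Trevisan 2006, §2.2, closing remark: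
replace the failure symbol `⊥` by an arbitrary answer) and `HeurP_subset_HeurBPP_holds` (§2.3: a
deterministic heuristic scheme is a randomized one), rather than along `AvgP ⊆ AvgBPP ⊆ HeurBPP`
as the fact's docstring suggests — the second step of that route, `AvgBPP_subset_HeurBPP`
(majority-vote amplification), is a named fact not discharged in the tree; either way this is an
instance of "the standard containments `Avg C ⊆ Heur C`" of §2.3.
[Bogdanov–Trevisan 2006, §2.2 (closing remark; arXiv:cs/0606037v3, after Def. 11) and §2.3
("standard containments `Avg C ⊆ Heur C`"); Impagliazzo 1995, §4]
[cite: BogdanovTrevisan2006, §2.3 (standard containments Avg C ⊆ Heur C; with §2.2 closing remark)] -/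
theorem noPessilandHeur_of_noPessiland_holds : noPessilandHeur_of_noPessiland :=
  fun h hH => h fun hA =>
    hH (hA.trans (Set.Subset.trans MetaComplexity.AvgP_subset_HeurP_holds
      MetaComplexity.HeurP_subset_HeurBPP_holds))

/-! ### crypto-foundations.S25: the `DistNP` form from the `(NP, U)` form

`Sweep1.lean` states Bogdanov–Trevisan's "one-way functions imply `(NP, U) ⊄ HeurBPP`" (the
contrapositive of §4.3, arXiv:cs/0606037v3 Thm. 26: if `(NP, U) ⊆ HeurBPP` then every
polynomial-time computable family `fₙ` is invertible on a `1 - δ` fraction of `x ∼ Uₙ`) as the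
named fact `distClass_NP_uniform_not_subset_HeurBPP_of_OWFExist`, and its `DistNP` consequence as
the named fact `DistNP_not_subset_HeurBPP_of_OWFExist`, whose interim proof from the former is
restored here: `(NP, U) ⊆ (NP, PSamp) = DistNP` because the uniform ensemble is samplable
(`uniformEnsemble_mem_PSamp_holds`, §2.1). -/

/-- **`DistNP ⊄ HeurBPP` from `(NP, U) ⊄ HeurBPP`** (crypto-foundations.S25, the `DistNP` form
from the uniform-ensemble form): if one-way functions imply `(NP, U) ⊄ HeurBPP`
(`distClass_NP_uniform_not_subset_HeurBPP_of_OWFExist`, Bogdanov–Trevisan §4.3) then they imply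
`DistNP ⊄ HeurBPP`, since `(NP, U) ⊆ DistNP` — the uniform ensemble is polynomial-time samplable
(`uniformEnsemble_mem_PSamp_holds`). This is the interim proof of `Sweep1.lean`, with the cited
result entering as a hypothesis (D-0014) and the prelude fact now discharged.
[Bogdanov–Trevisan 2006, §2.1 (Def. 2.1, the uniform ensemble; Def. 2.3) and §4.3
(arXiv:cs/0606037v3, Thm. 26)] [cite: BogdanovTrevisan2006, §2.1 (Def. 2.1, Def. 2.3) with §4.3] -/
theorem DistNP_not_subset_HeurBPP_of_OWFExist_of
    (h₂₅ : distClass_NP_uniform_not_subset_HeurBPP_of_OWFExist) :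
    DistNP_not_subset_HeurBPP_of_OWFExist :=
  fun h hD => h₂₅ h fun Q hQ =>
    hD ⟨hQ.1, by
      have hU : Q.dist = MetaComplexity.uniformEnsemble := Set.mem_singleton_iff.mp hQ.2
      rw [hU]
      exact MetaComplexity.uniformEnsemble_mem_PSamp_holds⟩

end Literature.Computability.Cryptography
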